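import Summits.BirchSwinnertonDyer.BirchSwinnertonDyer.Theorems.ResidualThetaTransportAtTwoResidualSignedLambdaLowerCMAtTwoFourTermOneSided
import Summits.BirchSwinnertonDyer.BirchSwinnertonDyer.Theorems.ResidualThetaTransportAtTwoLambdaLowerBoundOWeierstrass

/-!
# Sketch (stub-ideation k2 g16, `stub_cmLambdaLower`, crux stmt-BirchSwinnertonDyer-26074) — BY-NAME TREE MATCH
# for the `(ii)`-clauses of the S3′ hold `KatoZetaCMFormAtTwoSupply` in Kato-package currency

BSD is NOT proved by anything here; RSL_g (stmt-22608) and (R≥)ᵖ (stmt-26074) stay OPEN. Nothing about any curve or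
form is asserted: pure algebra over `Λ = A⟦X⟧` (`A` a complete DVR, `F = Frac A`), λ-currency `dim_F (F ⊗_A ·)`.

WHAT. The literature-transfer dictionary of the card `Ideas/stub-cmlambdalower-k2-g16.md` sends the print inputs of the
S3′ hold to EXISTING tree declarations; this file is the kernel receipt that the named declarations COMPOSE, with
matching currencies, into the `(ii_fin) ∧ (ii_D′)` clauses of S3′ for the decorated element `z := D • z₀`:

| print (source, page)                                              | tree socket (by name)                                                        |
|-------------------------------------------------------------------|-------------------------------------------------------------------------------|
| Kato Thm 12.4 (1), (12.2.1): `𝐇²_Γ(T_g)` f.g. torsion             | `Kato2004.ZetaQuotientPackage.finite_H2 / isTorsion_H2`                       |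
| Kato Thm 12.5 (2) + 12.6: `𝐇¹_Γ/Z` torsion                        | `Kato2004.ZetaQuotientPackage.isTorsion_quotient`                             |
| [BT26] Thm 2.6 (p. 5), CM, ANY `p`: `ξ(𝐇²) = ξ(𝐇¹/Z)` in `Λ ⊗ ℚ`,  | one-sided unfolding `∃ c d ≠ 0, (C c)·char H2 ≤ (C d)·char(𝐇¹/Z)` consumed by   |
|   = [ABS22-App.B–S] Thm 10.6 on the Γ-line in `X_st`-guise of `𝐇²` | `CharIdealLambda.finrank_baseChange_zetaQuotient_le_H2_of_span_C_mul_charIdeal_le` |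
| `Z_Γ ⊗ ℚ` principal (Kato 12.4 (2)(3) + PID `A⟦X⟧[1/ϖ]`)          | hypothesis `hgen : c₀ • Z ≤ Λ z₀` (generator up to a constant) — §2 below       |
| decoration `z = D • z₀` (Euler factors at `S₀`, units)             | `CharIdealLambda.finrank_baseChange_quotient_span_smul_eq_add` (C2)            |
| PORT (not print): compact Poitou–Tate `λ(𝐇²) ≤ λ(Sel₀^∨)`         | hypothesis `hPT` (k2-g7 flank; onepair (ii_D′) right-hand side)                |

§1 torsion transfer along a constant isogeny; §2 `λ(H/N) = λ(H/Z)` when a constant kills `Z/N`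
(`LambdaLowerBoundO.finrank_baseChange_eq_of_surjective_of_smul_ker_eq_zero`); §3 the composition.
-/

set_option autoImplicit false
set_option linter.dupNamespace false

noncomputable section

open scoped TensorProduct Classical

namespace Summit.BirchSwinnertonDyer.BirchSwinnertonDyer.Cruxes.ResidualThetaCountLowerPureAtTwo.SideaK2G16

open Literature.NumberTheory.EllipticCurves Literature.NumberTheory.EllipticCurves.Kato2004
open Literature.NumberTheory.GaloisRepresentations
open Summit.BirchSwinnertonDyer.BirchSwinnertonDyer.Theorems

/-! ## §1 Torsion transfer: `H/Z` torsion and `a • Z ≤ N ≤ Z` (`a ≠ 0`) ⇒ `H/N` torsion -/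

theorem isTorsion_quotient_of_smul_le {R : Type*} [CommRing R] [IsDomain R] {H : Type*} [AddCommGroup H]
    [Module R H] {N Z : Submodule R H} (a : R) (ha : a ≠ 0) (haZ : ∀ z ∈ Z, a • z ∈ N)
    (hZ : Module.IsTorsion R (H ⧸ Z)) : Module.IsTorsion R (H ⧸ N) := by
  intro x
  induction x using Submodule.Quotient.induction_on with
  | H y =>
    obtain ⟨⟨b, hb⟩, hby⟩ := @hZ (Z.mkQ y)
    rw [Submonoid.mk_smul, Submodule.mkQ_apply, ← Submodule.Quotient.mk_smul,
      Submodule.Quotient.mk_eq_zero] at hby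
    refine ⟨⟨a * b, mem_nonZeroDivisors_of_ne_zero (mul_ne_zero ha (nonZeroDivisors.ne_zero hb))⟩, ?_⟩
    rw [Submonoid.mk_smul, ← Submodule.Quotient.mk_smul, Submodule.Quotient.mk_eq_zero, mul_smul]
    exact haZ _ hby

/-! ## §2 A constant isogeny is λ-invisible: `λ(H/N) = λ(H/Z)` for `N ≤ Z` with `c • Z ≤ N`, `c ∈ A ∖ 0` a unit in `F` -/

theorem finrank_baseChange_quotient_eq_of_smul_le {A : Type*} [CommRing A] (F : Type*) [Field F] [Algebra A F]
    {Λ : Type*} [CommRing Λ] [Algebra A Λ] {H : Type*} [AddCommGroup H] [Module Λ H] [Module A H]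
    [IsScalarTower A Λ H] {N Z : Submodule Λ H} (hle : N ≤ Z) (c : A) (hc : IsUnit (algebraMap A F c))
    (hcZ : ∀ z ∈ Z, c • z ∈ N) :
    Module.finrank F (F ⊗[A] (H ⧸ N)) = Module.finrank F (F ⊗[A] (H ⧸ Z)) := by
  refine LambdaLowerBoundO.finrank_baseChange_eq_of_surjective_of_smul_ker_eq_zero F
    ((Submodule.factor hle).restrictScalars A) (Submodule.factor_surjective hle) c hc ?_
  intro x hx
  obtain ⟨h, rfl⟩ := Submodule.Quotient.mk_surjective N x
  rw [LinearMap.mem_ker, LinearMap.restrictScalars_apply] at hx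
  change Submodule.factor hle (N.mkQ h) = 0 at hx
  rw [Submodule.factor_mk, Submodule.mkQ_apply, Submodule.Quotient.mk_eq_zero] at hx
  rw [← Submodule.Quotient.mk_smul, Submodule.Quotient.mk_eq_zero]
  exact hcZ h hx

/-! ## §3 The composition: `(ii_fin) ∧ (ii_D′)` of S3′ for `z := D • z₀` from Kato's package, [BT26] 2.6 one-sided,
## a generator-up-to-constant `z₀` of `Z_Γ`, and the Poitou–Tate port `λ(𝐇²) ≤ λ(X₀)` -/

/-- **`(ii)`-clauses adapter.** For Kato's package `P` on `𝐇¹_Γ(T)` (`A` a complete DVR, `F = Frac A`), the one-sided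
char-ideal relation `(C c)·char 𝐇² ≤ (C d)·char(𝐇¹_Γ/Z)` ([BT26] Thm 2.6 ⊗ℚ, the half RSL_g consumes), an element
`z₀ ∈ Z` without `Λ`-torsion generating `Z` up to the constant `c₀ ≠ 0`, a decoration `D ≠ 0`, and the port
`λ(𝐇²) ≤ λ(X₀)`: `F ⊗ 𝐇¹_Γ/Λ(D•z₀)` is finite-dimensional and `λ(𝐇¹_Γ/Λ(D•z₀)) ≤ λ(X₀) + λ(Λ/(D))` — literally the
`(ii_fin) ∧ (ii_D′)` conjuncts of onepair's S3/S3′ with `Sel₀^∨ := X₀`. BSD is not advanced; nothing is instantiated. -/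
theorem ii_clauses_of_package {A : Type} [CommRing A] [TopologicalSpace A] [IsDomain A] [IsDiscreteValuationRing A]
    [IsAdicComplete (IsLocalRing.maximalIdeal A) A] {V : Type} [AddCommGroup V] [Module A V] [TopologicalSpace V]
    [IsTopologicalAddGroup V] [ContinuousSMul A V] {T : GaloisRep ℚ A V} {p : ℕ} [Fact p.Prime]
    {κ : ZpExtension ℚ p} {γ : Field.absoluteGaloisGroup ℚ} {I : IwasawaH1DataCoeff T p κ γ}
    (hI : Module.Finite (PowerSeries A) I.H) [Module A I.H] [IsScalarTower A (PowerSeries A) I.H]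
    (P : ZetaQuotientPackage I) [Module A P.H2] [IsScalarTower A (PowerSeries A) P.H2]
    (hP : ∃ c d : A, c ≠ 0 ∧ d ≠ 0 ∧
      Ideal.span {PowerSeries.C c} * P.charH2 ≤ Ideal.span {PowerSeries.C d} * P.charZetaQuotient)
    (F : Type) [Field F] [Algebra A F] [IsFractionRing A F]
    (z₀ : I.H) (hz₀ : z₀ ∈ P.Z) (hz₀tf : ∀ a : PowerSeries A, a • z₀ = 0 → a = 0)
    (c₀ : A) (hc₀ : c₀ ≠ 0) (hgen : ∀ z ∈ P.Z, c₀ • z ∈ Submodule.span (PowerSeries A) {z₀})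
    (D : PowerSeries A) (hD : D ≠ 0)
    {X₀ : Type} [AddCommGroup X₀] [Module A X₀]
    (hPT : Module.finrank F (F ⊗[A] P.H2) ≤ Module.finrank F (F ⊗[A] X₀)) :
    Module.Finite F (F ⊗[A] (I.H ⧸ Submodule.span (PowerSeries A) {D • z₀})) ∧
      Module.finrank F (F ⊗[A] (I.H ⧸ Submodule.span (PowerSeries A) {D • z₀})) ≤
        Module.finrank F (F ⊗[A] X₀) + Module.finrank F (F ⊗[A] (PowerSeries A ⧸ Ideal.span {D})) := by
  haveI := hI
  set Λz := Submodule.span (PowerSeries A) {z₀} with hΛz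
  set ΛDz := Submodule.span (PowerSeries A) {D • z₀} with hΛDz
  have hleZ : Λz ≤ P.Z := by
    rw [hΛz, Submodule.span_singleton_le_iff_mem]; exact hz₀
  have hleD : ΛDz ≤ Λz := by
    rw [hΛDz, Submodule.span_singleton_le_iff_mem]
    exact Submodule.smul_mem _ _ (Submodule.mem_span_singleton_self z₀)
  -- the constant `c₀` as an element of `Λ`
  have hCc₀ : (PowerSeries.C c₀ : PowerSeries A) ≠ 0 := fun h =>
    hc₀ (PowerSeries.C_injective (by rw [h, map_zero]))
  have hgenΛ : ∀ z ∈ P.Z, (PowerSeries.C c₀ : PowerSeries A) • z ∈ Λz := fun z hz => by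
    rw [PowerSeries.C_eq_algebraMap, algebraMap_smul]; exact hgen z hz
  -- (a) `𝐇¹/Λz₀` and `𝐇¹/ΛDz₀` are torsion
  have htors : Module.IsTorsion (PowerSeries A) (I.H ⧸ Λz) :=
    isTorsion_quotient_of_smul_le (PowerSeries.C c₀) hCc₀ hgenΛ P.isTorsion_quotient
  have htorsD : Module.IsTorsion (PowerSeries A) (I.H ⧸ ΛDz) := by
    refine isTorsion_quotient_of_smul_le D hD (fun z hz => ?_) htors
    rw [hΛz, Submodule.mem_span_singleton] at hz
    obtain ⟨b, rfl⟩ := hz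
    rw [smul_smul, mul_comm, ← smul_smul, hΛDz]
    exact Submodule.smul_mem _ _ (Submodule.mem_span_singleton_self _)
  -- (b) `(ii_fin)`
  have hfin : Module.Finite F (F ⊗[A] (I.H ⧸ ΛDz)) := CharIdealLambda.finite_baseChange_of_isTorsion F _ htorsD
  refine ⟨hfin, ?_⟩
  -- (c) constant isogeny: `λ(𝐇¹/Λz₀) = λ(𝐇¹/Z)`
  have hunit : IsUnit (algebraMap A F c₀) := by
    refine isUnit_iff_ne_zero.mpr fun h => hc₀ (IsFractionRing.injective A F ?_)
    rw [h, map_zero]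
  have h1 : Module.finrank F (F ⊗[A] (I.H ⧸ Λz)) = Module.finrank F (F ⊗[A] (I.H ⧸ P.Z)) :=
    finrank_baseChange_quotient_eq_of_smul_le F hleZ c₀ hunit hgen
  -- (d) decoration shift (C2) and the one-sided [BT26] flank
  have h2 := CharIdealLambda.finrank_baseChange_quotient_span_smul_eq_add F z₀ hz₀tf D hD htors
  have h3 := CharIdealLambda.finrank_baseChange_zetaQuotient_le_H2_of_span_C_mul_charIdeal_le hI P hP F
  rw [← hΛDz, ← hΛz] at h2
  omega

end Summit.BirchSwinnertonDyer.BirchSwinnertonDyer.Cruxes.ResidualThetaCountLowerPureAtTwo.SideaK2G16
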